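import Summits.BirchSwinnertonDyer.BirchSwinnertonDyer.Theses.GenusKolyvaginAtTwo
import Summits.BirchSwinnertonDyer.BirchSwinnertonDyer.Theorems.GenusKolyvaginAtTwoGenusDeepSupplyAtTwoNegDiscNarrowKFourCellHalvingDescentKFourNeg
import Summits.BirchSwinnertonDyer.BirchSwinnertonDyer.Theorems.K4Neg.Negative.K4NegFalseOfGenusLedgerPFrame
import HarnessLib

/-!
# SKELETON LINE `cut_split_sharp_class` for item 31526 `K4Neg` (route GenusKolyvaginAtTwo, ASIDE r202 — K₄⁻: deep 2-primitivity at positive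
# depth on the Δ < 0, #Sel₂(E) = 4 cell, PRIME FRAME K = ℚ(√−ℓ₀), 2 split)

line-writer skeleton (linewriter-bsd-genuskolyattwo-1 g0); NOT leaf progress. `K4Neg` = binder `hK4` of
`GenusSupplyNarrow.PrimeFrame.stubC_prime_of_selmerSplit_mixed` (p766796): on every prime Heegner frame of a K₄⁻ habitat curve with y_K of exact
2-depth M₀ ≥ 1 and a Sel₂-minimal rank-one twin, SOME square-free level n of FrobEqFrobInfty Kolyvagin primes of index ≥ 2 carries a 2-PRIMITIVE
derived point P_d(n) ∉ 2E(K[n]).  THE SPLIT (by the multiplicative CUT and the depth), composed from LANDED theorems: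
* ON THE CUT (an odd prime v ∣ N_E of multiplicative reduction), DEPTH ONE (M₀ = 1): a THEOREM modulo Q2 — gk2-p5 g36's
  `GenusExact.PlusDescent.kFourNeg_conclusion_of_depth_one_of_hasMultiplicativeReductionAt` (= closed support item `K4NegDepthOneOnCut` 33814);
  no stub but Q2.
* ON THE CUT, DEPTH ≥ 2: gk2-p5 g36's B2Q♭ `kFourNeg_shape_of_two_pow_pred_smul_ne_zero` (McCallum §5 Thm 5.4 halving descent over ℚ +
  gk2-p2's FrobEqFrobInfty pair-Čebotarev) turns ONE class s₀ ∈ Sel_{2^M}(E/ℚ) with 2^{M₀−1}·s₀ ≠ 0 into K4Neg's conclusion at a single prime;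
  the input «Ш(E/ℚ)[2^∞] has exponent ≥ 2^{M₀}» is stub SHARP [research; EXPECTED TRUE: it follows from BSD₂(E) ∧ BSD₂(Wd) through the
  Gross–Zagier index identity #Ш(E/K)[2^∞] = 4^{M₀} and Cassels–Tate on Ш(E/ℚ)[2] ≅ (ℤ/2)² — g36 §4 `kFourNeg_shape_of_nonCMAtTwo_onCut`
  records that K4Neg is LOSSLESS on the cut (leaf ⟹ K4Neg there)].
* OFF THE CUT (no odd multiplicative prime): stub OFFCUT [research; EXPECTED FALSE AS TYPED on the loc₂-silent PHANTOM sub-cell: the landed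
  NEGATIVE LEMMA `K4NegNegative.k4Neg_false_of_genusLedgerPFrame : GenusLedgerPFrameAtTwo → ¬ K4Neg` (gk2-p3 g36; H = «a loc₂-silent phantom
  𝒫-frame carrying the genus–Gross–Zagier ledger exists», BSD₂-grade, numerically supported memo §5/§7) kills exactly this stub's β-frames; its
  α-frames (loc_{ℓ₀} ξ_E ≠ 0, infinite supply by `exists_levelFour_phantom_twistingPrime`, Theorems/GenusKolyvaginAtTwoK4NegPhantomCellDescentBitSupply) and the 2-multiplicative slice
  (`k4Neg_offCutNonPhantomAtTwo_of_hasMultiplicativeReductionAt_two`) are the live part].  This is WHY the item is an aside (director (691)/(696)(4)).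
* Q2 = route item `KolyvaginRelationAtTwo` (24880) BY NAME [print: Kolyvagin's Euler-system relation at p = 2, = print item 23091].
Composition `K4Neg_of` PROVED from the three stubs (root number +1 from r_an = 0 by the tree's `rootNumber_eq_one_of_even_analyticRank`).
Negative lemma honoured and re-checked below (`example`).  Sorries ONLY inside `stub_*`; BSD is proved for no curve; K4Neg is NOT proved.
-/

set_option autoImplicit false
set_option linter.dupNamespace false

noncomputable section

namespace Summit.BirchSwinnertonDyer.BirchSwinnertonDyer.Cruxes.K4Neg.CutSplitSharpClass

open scoped Classical NumberField
open WeierstrassCurve NumberField IsDedekindDomain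
open Literature.NumberTheory.EllipticCurves Literature.NumberTheory.EllipticCurves.ModularForms
open Summit.BirchSwinnertonDyer.BirchSwinnertonDyer.Theses.GenusKolyvaginAtTwo (K4Neg KolyvaginRelationAtTwo)
open Summit.BirchSwinnertonDyer.BirchSwinnertonDyer.Theorems.GenusExact.PlusDescent
  (kFourNeg_shape_of_two_pow_pred_smul_ne_zero kFourNeg_conclusion_of_depth_one_of_hasMultiplicativeReductionAt)

/-- NEGATIVE LEMMA HONOURED (kernel re-check, gk2-p3 g36): modulo the BSD₂-grade construction hypothesis `GenusLedgerPFrameAtTwo`, `K4Neg` is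
false — the obstruction lives entirely inside `stub_offCut` below (phantom, loc₂-silent frames are off the cut by definition). -/
example (h : Summit.BirchSwinnertonDyer.BirchSwinnertonDyer.Theorems.K4NegNegative.GenusLedgerPFrameAtTwo) : ¬ K4Neg :=
  Summit.BirchSwinnertonDyer.BirchSwinnertonDyer.Theorems.K4NegNegative.k4Neg_false_of_genusLedgerPFrame h

/-- [print · ITEM BY NAME `KolyvaginRelationAtTwo` 24880 (= print 23091)] Q2: Kolyvagin's Euler-system relation for derived Heegner classes at
p = 2 (the `2`-adic form of [Kolyvagin1989Izv, §3 Prop. 3] / [GrossLMS1991, §3 Prop. 3.7]). [cite: GrossLMS1991, §3 Prop. 3.7] [cite: Kolyvagin1989Izv, §3] -/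
theorem stub_Q2 : KolyvaginRelationAtTwo := by
  sorry

/-- [research · EXPECTED TRUE (⟸ BSD₂ of the pair (E, Wd)); size XL] SHARP: on the cut, at depth M₀ ≥ 2, `Sel_{2^∞}(E/ℚ)` has a class of order
`≥ 2^{M₀}` — i.e. Ш(E/ℚ)[2^∞] ≅ (ℤ/2^a)² with a ≥ M₀.  Heuristic road: Gross–Zagier V (2.2) + BSD₂(E) + BSD₂(Wd) + Milne/Kramer give
#Ш(E/K)[2^∞] = 4^{M₀}; #Sel₂(Wd) = 2 at rank 1 kills Ш(Wd)[2]; Cassels–Tate squares Ш(E/ℚ)[2^∞] on Ш[2] ≅ (ℤ/2)².  No BSD-free road known.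
[cite: GrossZagier1986, V §2 (2.2)] [cite: McCallumLMS1991, §5 Thm. 5.4] [cite: Kramer1981, Thm. 1] -/
theorem stub_sharpSelmerClass_onCut_of_two_le_depth :
    ∀ (W : WeierstrassCurve ℚ) [W.IsElliptic] [W.IsGloballyMinimal] [NeZero (W.conductorNorm ℤ)], ¬ W.HasCM → W.analyticRank = 0 →
      (∀ n : ℕ, 0 < n → W.HasSurjectiveModNGaloisRep ((2 : ℤ) ^ n)) → Odd W.tamagawaProduct → W.Δ < 0 → Nat.card (W.selmerGroup 2) = 4 →
      ∀ (v : HeightOneSpectrum (𝓞 ℚ)), ((2 : ℕ) : 𝓞 ℚ) ∉ v.asIdeal → ((W.conductorNorm ℤ : ℕ) : 𝓞 ℚ) ∈ v.asIdeal → W.HasMultiplicativeReductionAt v →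
      ∀ (K : Type) [Field K] [NumberField K], IsImaginaryQuadratic K → Odd (NumberField.discr K) → NumberField.discr K ≠ -3 →
      SatisfiesHeegnerHypothesis (W.conductorNorm ℤ) K → ¬ IsSquare ((NumberField.discr K : ℚ) * -|W.Δ|) →
      ¬ IsSquare ((NumberField.discr K : ℚ) * (-(2 * |W.Δ|))) →
      ∀ (Dt : ModularParametrizationData W (W.conductorNorm ℤ)), (∀ z ∈ Dt.L.lattice, ∃ w ∈ periodLattice Dt.f, z = (Dt.c : ℂ) * w) → Odd Dt.c →
      ∀ (β : ℤ) (ι : K →+* ℂ) (d₁ : KolyvaginHeegnerData Dt β ι 1), ¬ IsOfFinAddOrder d₁.derivedPoint → ∀ (M₀ : ℕ),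
      (∃ Q : (W.baseChange (ringClassField K ι 1)).toAffine.Point, ((2 ^ M₀ : ℕ) : ℤ) • Q = d₁.derivedPoint) →
      (¬ ∃ Q : (W.baseChange (ringClassField K ι 1)).toAffine.Point, ((2 ^ (M₀ + 1) : ℕ) : ℤ) • Q = d₁.derivedPoint) → 2 ≤ M₀ →
      ∀ (Wd : WeierstrassCurve ℚ) [Wd.IsElliptic] [Wd.IsGloballyMinimal],
      (∃ C : WeierstrassCurve.VariableChange ℚ, C • W.quadraticTwist (NumberField.discr K : ℚ) = Wd) → Wd.analyticRank = 1 →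
      Nat.card (Wd.selmerGroup 2) = 2 → padicValNat 2 Wd.tamagawaProduct ≤ 1 →
      ∃ (M : ℕ) (s₀ : galH1Torsion W ((2 ^ M : ℕ) : ℤ)), s₀ ∈ selmerGroup W ((2 ^ M : ℕ) : ℤ) ∧ ((2 ^ (M₀ - 1) : ℕ) : ℤ) • s₀ ≠ 0 := by
  sorry

/-- [research · EXPECTED FALSE AS TYPED on the loc₂-silent phantom sub-cell (negative lemma `k4Neg_false_of_genusLedgerPFrame`, BSD₂-grade H);
live on the α-frames / the 2-multiplicative slice] OFFCUT: K4Neg's binders VERBATIM for a curve with NO odd multiplicative prime.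
[cite: LawsonWuthrich2016, §7.1] [cite: GrossLMS1991, §3 (3.1)–(3.3)] [cite: MazurRubin2010, Lemma 3.2] -/
theorem stub_offCut :
    ∀ (W : WeierstrassCurve ℚ) [W.IsElliptic] [W.IsGloballyMinimal] [NeZero (W.conductorNorm ℤ)],
      (¬ ∃ v : HeightOneSpectrum (𝓞 ℚ), ((2 : ℕ) : 𝓞 ℚ) ∉ v.asIdeal ∧ ((W.conductorNorm ℤ : ℕ) : 𝓞 ℚ) ∈ v.asIdeal ∧ W.HasMultiplicativeReductionAt v) →
      ¬ W.HasCM → W.analyticRank = 0 →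
      (∀ n : ℕ, 0 < n → W.HasSurjectiveModNGaloisRep ((2 : ℤ) ^ n)) → Odd W.tamagawaProduct → W.Δ < 0 → Nat.card (W.selmerGroup 2) = 4 →
      ∀ (K : Type) [Field K] [NumberField K], IsImaginaryQuadratic K → Odd (NumberField.discr K) → NumberField.discr K ≠ -3 →
      SatisfiesHeegnerHypothesis (W.conductorNorm ℤ) K → ¬ IsSquare ((NumberField.discr K : ℚ) * -|W.Δ|) →
      ¬ IsSquare ((NumberField.discr K : ℚ) * (-(2 * |W.Δ|))) → ∀ (ℓ₀ : ℕ), ℓ₀.Prime → NumberField.discr K = -(ℓ₀ : ℤ) →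
      ((Ideal.span {(2 : ℤ)}).primesOver (NumberField.RingOfIntegers K)).ncard = 2 →
      ∀ (Dt : ModularParametrizationData W (W.conductorNorm ℤ)), (∀ z ∈ Dt.L.lattice, ∃ w ∈ periodLattice Dt.f, z = (Dt.c : ℂ) * w) → Odd Dt.c →
      ∀ (β : ℤ) (ι : K →+* ℂ) (d₁ : KolyvaginHeegnerData Dt β ι 1), ¬ IsOfFinAddOrder d₁.derivedPoint → ∀ (M₀ : ℕ),
      (∃ Q : (W.baseChange (ringClassField K ι 1)).toAffine.Point, ((2 ^ M₀ : ℕ) : ℤ) • Q = d₁.derivedPoint) →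
      (¬ ∃ Q : (W.baseChange (ringClassField K ι 1)).toAffine.Point, ((2 ^ (M₀ + 1) : ℕ) : ℤ) • Q = d₁.derivedPoint) → 1 ≤ M₀ →
      ∀ (Wd : WeierstrassCurve ℚ) [Wd.IsElliptic] [Wd.IsGloballyMinimal],
      (∃ C : WeierstrassCurve.VariableChange ℚ, C • W.quadraticTwist (NumberField.discr K : ℚ) = Wd) → Wd.analyticRank = 1 →
      Nat.card (Wd.selmerGroup 2) = 2 → padicValNat 2 Wd.tamagawaProduct ≤ 1 →
      ∃ (n : ℕ) (d : KolyvaginHeegnerData Dt β ι n), Squarefree n ∧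
        (∀ ℓ ∈ n.primeFactors, Zhang2014.IsKolyvaginPrime (W.conductorNorm ℤ) W K 2 ℓ ∧ 2 ≤ Zhang2014.kolyvaginIndex W 2 ℓ ∧
          FrobEqFrobInfty W K 2 ℓ) ∧
        ¬ ∃ Q : (W.baseChange (ringClassField K ι n)).toAffine.Point, (2 : ℤ) • Q = d.derivedPoint := by
  sorry

/-- **Composition (kernel-checked): `K4Neg`** (item 31526) BY NAME.  Cut ∧ depth 1: landed theorem mod Q2; cut ∧ depth ≥ 2: B2Q♭ on the SHARP
class mod Q2; off the cut: OFFCUT. [cite: McCallumLMS1991, §5 Thm. 5.4] [cite: Kolyvagin1989Izv, Thm. B₂] [cite: GrossLMS1991, §3] -/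
theorem K4Neg_of : K4Neg := by
  intro W _ _ _ hcm hr0 hρ hT hΔ hS4 K _ _ hIQ hodd h3 hHe hsq1 hsq2 ℓ₀ hℓ₀ hdK h2K Dt hMan hc β ι d₁ hy M₀ hdiv hndiv hM Wd _ _ hWd hr1 hS2 htam
  by_cases hcut : ∃ v : HeightOneSpectrum (𝓞 ℚ), ((2 : ℕ) : 𝓞 ℚ) ∉ v.asIdeal ∧ ((W.conductorNorm ℤ : ℕ) : 𝓞 ℚ) ∈ v.asIdeal ∧
      W.HasMultiplicativeReductionAt v
  · obtain ⟨v, h2v, hNv, hmult⟩ := hcut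
    rcases Nat.lt_or_ge M₀ 2 with hlt | hge
    · have hM1 : M₀ = 1 := by omega
      exact kFourNeg_conclusion_of_depth_one_of_hasMultiplicativeReductionAt stub_Q2 W hcm hr0 hρ hT hΔ hS4 v h2v hNv hmult K hIQ hodd h3
        hHe hsq1 hsq2 ℓ₀ hℓ₀ hdK h2K Dt hMan hc β ι d₁ hy M₀ hdiv hndiv hM1 Wd hWd hr1 hS2 htam
    · have hw1 : W.rootNumber = 1 := W.rootNumber_eq_one_of_even_analyticRank (by rw [hr0]; exact Even.zero)
      exact kFourNeg_shape_of_two_pow_pred_smul_ne_zero stub_Q2 W hcm hΔ hT v h2v hNv hmult K hIQ hodd h3 hHe hsq1 hsq2 hρ Dt β ι d₁ M₀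
        hndiv hw1 (stub_sharpSelmerClass_onCut_of_two_le_depth W hcm hr0 hρ hT hΔ hS4 v h2v hNv hmult K hIQ hodd h3 hHe hsq1 hsq2 Dt hMan
          hc β ι d₁ hy M₀ hdiv hndiv hge Wd hWd hr1 hS2 htam)
  · exact stub_offCut W hcut hcm hr0 hρ hT hΔ hS4 K hIQ hodd h3 hHe hsq1 hsq2 ℓ₀ hℓ₀ hdK h2K Dt hMan hc β ι d₁ hy M₀ hdiv hndiv hM Wd hWd
      hr1 hS2 htam

end Summit.BirchSwinnertonDyer.BirchSwinnertonDyer.Cruxes.K4Neg.CutSplitSharpClass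

end
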